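import Summits.AtomisticToContinuum.Crystallization.Theorems.FrustratedLawDichotomyStrainedPatchTextureFloor

/-!
# Strained patch — the SECOND-VARIATION CHARGE `SVCharge`, the SLACK certificate `SlackCert`, their SEAM, and the WINDOW lemma (lens-5 g70, §4 of memo NODE-g70)

decomp-a2c lens-5 («finite/base range + asymptotic regime + bridge»), crux `AperiodicFrustratedLawGap` (stmt-AtomisticToContinuum-27623), T-side record
`[CORE-FAR] CoreOffTubeFloor (63/10) (63/10) (24/5) (1/100) 0 ⟸ TubeP ∧ CoverP`.  New module on top of the landed `…StrainedPatchTextureFloor` (critic row 1186 (A6)(2):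
«land §4 as a NEW module importing the tree file»); zero edits to landed declarations.

WHAT IT TYPES (critic rows 1183 (C)/(F)(2), 1186 (A6)).  The texture-priced certificates (66R/67S, and the ℓ² leaf `InteriorTexLaw` of the parent file) price the
second-order remainder of each reach row TERMWISE (2–4 σ₁ per row at τ = 1/80); the TRUE remainder measured on admissible-looking tube states is 0.24–0.85 σ₁
adversarial, ≤ 0.12 σ₁ typical (memo §6).  The quantity to price is therefore the remainder itself — per reach row, the true move-test force minus its
linearisation through the record tables `(hessBlk0, force0)` of g57 (`…StrainedPatchQuantSlaving`):

* §1 `constLaw τ` (the constant coarse law) · ★ `SVCharge 𝓘 τ κ X := ForceTaylorBound 𝓘 τ τ (constLaw τ) (κ·σ₁) hessBlk0 force0 X` [ANALYTIC · INSTRUMENTABLE —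
  the (SV) leaf: remainder ≤ κσ₁ + X(z₀)(e a) per reach row; `X` prices the UNCHARTED exterior partners of the row (the exterior (63/10, 133/10] is Sep-only
  free, critic row 1183 (A)), `X = 0` = engine convention] · ★ `SlackCert 𝓘 τ κ σ H F X` [INSTRUMENTABLE — the first-order certificate with κ-INFLATED force rows
  = census `CERT(s)`, `s = 1 + κ` (ASK-70 (e))] · SEAMS `tubeFloor_of_enclosure_of_slackCert` (through g57's `SlavingEnclosure`) and ★ `tubeFloor_of_svCharge_of_slackCert :
  0 ≤ τ → SVCharge 𝓘 τ κ X → SlackCert 𝓘 τ κ σ₁ hessBlk0 force0 X → TubeFloor 𝓘 τ` (through the TREE THEOREM `forceCapOne`) · `slackCert_of_tubeFloor` (never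
  stronger than TF) · monotonicity `SlackCert.anti`, `SVCharge.mono`, `SVCharge.anti_family` (`sigmaOne_pos` from the tree `…ChartFamiliesPinned`) · record junction `coreOff_record_of_svCharge … (hCov :
  CoverP) : CoreOffTubeFloor (63/10) (63/10) (24/5) (1/100) 0` · witness format `SVWitness` + `not_svCharge_of_witness`.
* §2 THE WINDOW LEMMA [formal bookkeeping, answers critic row 1186 (A6)(1)]: `Admissible M z c` already CONTAINS the strain window — every reach site of an
  admissible cluster is FRUSTRATED: `not_goodAtScale_of_admissible` (`IsReach z c a → ¬GoodAtScale (1/20) (3/2) z a`) and `not_moveUnstable_of_admissible`.  Hence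
  every law / certificate / witness format of this lane that is quantified over `Admissible` clusters (`RelTexture`, `RelTextureProfile`, `InteriorTexLaw`,
  `TexEnergyWitness`, `SVCharge`, `SlackCert`, `SVWitness`, `TubeFloor` itself) carries the window AT NO COST AT THE SEAM; a numerical state is a witness in these
  formats only if it passes the window (`η ≥ 1/20` at every reach site — census ADM-35: all sixteen exterior-driven / engine-set texture states of 2026-09-02 FAIL
  it on HE52, margin `1.8·10⁻³`), and a prover of a law may USE `¬GoodAtScale (1/20) (3/2) z a` at every reach row.  The budget `B : TexBudget` of `InteriorTexLaw` is
  indexed by the instance `(M₀, z₀)`, so a host-margin-dependent constant needs no re-typing either.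

No `sorry`, no new axioms; every theorem is a one-to-five-line composition over g57 / HostCells / ForceCap / the parent file.
-/

namespace Summit.AtomisticToContinuum.Crystallization.Theorems.FrustratedLawDichotomyStrainedPatchSVCharge

open scoped BigOperators Classical RealInnerProductSpace
open Summit.AtomisticToContinuum.Crystallization.Theorems.FrustratedLawDichotomyMotifLemmas
open Summit.AtomisticToContinuum.Crystallization.Theorems.FrustratedLawDichotomyAveragingCut
open Summit.AtomisticToContinuum.Crystallization.Theorems.FrustratedLawDichotomyStrainedPatchHomSplit
open Summit.AtomisticToContinuum.Crystallization.Theorems.FrustratedLawDichotomyStrainedPatchCleanCollar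
open Summit.AtomisticToContinuum.Crystallization.Theorems.FrustratedLawDichotomyStrainedPatchPhaseCut
open Summit.AtomisticToContinuum.Crystallization.Theorems.FrustratedLawDichotomyStrainedPatchCoreTube
open Summit.AtomisticToContinuum.Crystallization.Theorems.FrustratedLawDichotomyStrainedPatchAugmentedEnvelope
open Summit.AtomisticToContinuum.Crystallization.Theorems.FrustratedLawDichotomyStrainedPatchEnvelopeLaw
open Summit.AtomisticToContinuum.Crystallization.Theorems.FrustratedLawDichotomyStrainedPatchEnvelopeTaylor
open Summit.AtomisticToContinuum.Crystallization.Theorems.FrustratedLawDichotomyStrainedPatchChartFamilies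
open Summit.AtomisticToContinuum.Crystallization.Theorems.FrustratedLawDichotomyStrainedPatchQuantSlaving
open Summit.AtomisticToContinuum.Crystallization.Theorems.FrustratedLawDichotomyStrainedPatchHostCells
open Summit.AtomisticToContinuum.Crystallization.Theorems.FrustratedLawDichotomyStrainedPatchForceCap
open Summit.AtomisticToContinuum.Crystallization.Theorems.FrustratedLawDichotomyStrainedPatchRobustRows
open Summit.AtomisticToContinuum.Crystallization.Theorems.FrustratedLawDichotomyStrainedPatchStretchRows
open Summit.AtomisticToContinuum.Crystallization.Theorems.FrustratedLawDichotomyCollarCensus (Collar)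
open Summit.AtomisticToContinuum.Crystallization.Theorems.FrustratedLawDichotomyExemptAbsorptionRecord (NonEquilibriumCore)
open Summit.AtomisticToContinuum.Crystallization.Theorems.FrustratedLawDichotomyStrainedPatchTextureFloor

/-! ## §1. (SV) — the SECOND-VARIATION CHARGE feeding a SLACK certificate (memo §6; critic row 1183 (C),(F)(2))
The TRUE per-row remainder `‖siteForce 7 z a − linForce H₀ F₀ … a‖` on admissible tube states (measured 0.24 / 0.38 / 0.85 σ₁ at depth 0 / 3 / 4.5, vs 2–4 σ₁
termwise) is g57's `ForceTaylorBound` at the coarse radius; its consumer is a first-order certificate at force slack `(1 + κ)σ₁ + X` (`SlackCert`); the seam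
`(SV κ X) ∧ (FC σ₁ = forceCapOne) ∧ SlackCert ⟹ (TF)`.  Exterior FREE (row 1183 (A)) ⇒ `X` prices the uncharted partners of each reach row; `X = 0` = engine. -/

/-- The constant roughness law `T ≡ τ` (the record charts are `ChartBy 𝓘 τ τ`). -/
def constLaw (τ : ℝ) : LawTab := fun _ _ _ => τ

/-- ★ **(SV κ X) `SVCharge 𝓘 τ κ X`** [ANALYTIC · INSTRUMENTABLE — the second-variation charge] — on every admissible clean mono-phase `𝓘`-charted cluster (coarse =
fine radius `τ`) the TRUE move-test force at each reach row is within `κ·σ₁ + X(z₀)(e a)` of its linearisation through `(hessBlk0, force0)`; `:=` g57's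
`ForceTaylorBound` at `δ = τ`, `T ≡ τ`.  Memo §6: κ ≥ 0.85 at depth 4.5, ≥ 0.38 at depth ≤ 3 (X = 0, lower bounds from true states); termwise κ ≈ 2–4. -/
def SVCharge (𝓘 : ChartFam) (τ κ : ℝ) (X : SlackTab) : Prop := ForceTaylorBound 𝓘 τ τ (constLaw τ) (κ * sigmaOne) hessBlk0 force0 X

/-- ★ **`SlackCert 𝓘 τ κ σ H F X`** [INSTRUMENTABLE — one LP per instance at force slack `(1 + κ)σ + X`; census ASK-70 (e) `CERT(s)`, `s = 1 + κ`] — the score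
claim for every admissible clean mono-phase `𝓘`-charted cluster whose deviation field lies in the `κ`-inflated linear force polytope (g57 `InForcePolytope`). -/
def SlackCert (𝓘 : ChartFam) (τ κ σ : ℝ) (H : HessTab) (F : ForceTab) (X : SlackTab) : Prop :=
  ∀ (M : ℕ) (z : Fin M → E3) (c : Fin M) (M₀ : ℕ) (z₀ : Fin M₀ → E3) (c₀ : Fin M₀) (e : Fin M → Fin M₀),
    Admissible M z c → CleanBall (63 / 10) z c → MonoPhaseBall (63 / 10) z c → ChartBy 𝓘 τ τ z c z₀ c₀ e →
      InForcePolytope κ σ H F X z c z₀ c₀ e → 0 ≤ ballAvg (9 / 5) z (xRec M z) c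

/-- ★★ THE (SV) SEAM, general tables: (ENC κ) at the coarse radius ∧ `SlackCert κ` ⟹ (TF). [folklore] -/
theorem tubeFloor_of_enclosure_of_slackCert {𝓘 : ChartFam} {τ κ σ : ℝ} {H : HessTab} {F : ForceTab} {X : SlackTab} (hτ : 0 ≤ τ)
    (hE : SlavingEnclosure 𝓘 τ τ (constLaw τ) κ σ H F X) (hC : SlackCert 𝓘 τ κ σ H F X) : TubeFloor 𝓘 τ :=
  fun M z c M₀ z₀ c₀ e hz hcl hm hch =>
    hC M z c M₀ z₀ c₀ e hz hcl hm hch (hE M z c M₀ z₀ c₀ e τ hz hcl hm hτ le_rfl hch (fineChart_of_chartBy hch))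

/-- ★★ THE (SV) SEAM of record: (SV κ X) ∧ `SlackCert κ σ₁ hessBlk0 force0 X` ⟹ (TF), through the tree's force cap `forceCapOne`. [folklore] -/
theorem tubeFloor_of_svCharge_of_slackCert {𝓘 : ChartFam} {τ κ : ℝ} {X : SlackTab} (hτ : 0 ≤ τ) (hS : SVCharge 𝓘 τ κ X)
    (hC : SlackCert 𝓘 τ κ sigmaOne hessBlk0 force0 X) : TubeFloor 𝓘 τ :=
  tubeFloor_of_enclosure_of_slackCert hτ (slavingEnclosure_of_forceCap forceCapOne hS) hC

/-- (TF) ⟹ `SlackCert` at every slack: the certificate is never stronger than the claim it serves. [formal bookkeeping] -/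
theorem slackCert_of_tubeFloor {𝓘 : ChartFam} {τ : ℝ} (κ σ : ℝ) (H : HessTab) (F : ForceTab) (X : SlackTab) (h : TubeFloor 𝓘 τ) :
    SlackCert 𝓘 τ κ σ H F X := fun M z c M₀ z₀ c₀ e hz hcl hm hch _ => h M z c M₀ z₀ c₀ e hz hcl hm hch


/-- `SlackCert` is ANTITONE in the slack: a certificate at a larger slack serves a smaller one (`σ ≥ 0`). [formal bookkeeping] -/
theorem SlackCert.anti {𝓘 : ChartFam} {τ κ κ' σ : ℝ} (hκ : κ ≤ κ') (hσ : 0 ≤ σ) {H : HessTab} {F : ForceTab} {X : SlackTab}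
    (h : SlackCert 𝓘 τ κ' σ H F X) : SlackCert 𝓘 τ κ σ H F X :=
  fun M z c M₀ z₀ c₀ e hz hcl hm hch hP => h M z c M₀ z₀ c₀ e hz hcl hm hch (inForcePolytope_mono hκ hσ hP)

/-- (SV) is MONOTONE in the charge. [formal bookkeeping] -/
theorem SVCharge.mono {𝓘 : ChartFam} {τ κ κ' : ℝ} (hκ : κ ≤ κ') {X : SlackTab} (h : SVCharge 𝓘 τ κ X) : SVCharge 𝓘 τ κ' X :=
  fun M z c M₀ z₀ c₀ e t hz hcl hm ht htT hch hf a ha hr => by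
    have h₁ := h M z c M₀ z₀ c₀ e t hz hcl hm ht htT hch hf a ha hr
    have h₂ : κ * sigmaOne ≤ κ' * sigmaOne := mul_le_mul_of_nonneg_right hκ Summit.AtomisticToContinuum.Crystallization.Theorems.FrustratedLawDichotomyStrainedPatchChartFamiliesPinned.sigmaOne_pos.le
    linarith

/-- (SV) is ANTITONE in the family. [formal bookkeeping] -/
theorem SVCharge.anti_family {𝓘 𝓘' : ChartFam} (hle : FamilyLE 𝓘 𝓘') {τ κ : ℝ} {X : SlackTab} (h : SVCharge 𝓘' τ κ X) : SVCharge 𝓘 τ κ X :=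
  fun M z c M₀ z₀ c₀ e t hz hcl hm ht htT hch => h M z c M₀ z₀ c₀ e t hz hcl hm ht htT ⟨hle _ _ _ hch.1, hch.2⟩

/-- ★ RECORD JUNCTION [CORE-FAR] ⟸ (SV κ X) ∧ SlackCert(FamP, 1/80, κ, X) ∧ CoverP. [formal bookkeeping] -/
theorem coreOff_record_of_svCharge (κ : ℝ) (X : SlackTab) (hS : SVCharge FamP (1 / 80) κ X) (hC : SlackCert FamP (1 / 80) κ sigmaOne hessBlk0 force0 X)
    (hCov : CoverP) : CoreOffTubeFloor (63 / 10) (63 / 10) (24 / 5) (1 / 100) 0 := coreOff_record_of_tubeP_of_coverP (tubeFloor_of_svCharge_of_slackCert (by norm_num) hS hC) hCov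

/-- ★ **SV WITNESS** [INSTRUMENT-FED REFUTATION FORMAT]: an admissible charted cluster with a reach row of depth `≤ ρ` whose true-minus-linear force exceeds `q + X`. -/
def SVWitness (𝓘 : ChartFam) (τ ρ q : ℝ) (X : SlackTab) : Prop :=
  ∃ (M : ℕ) (z : Fin M → E3) (c : Fin M) (M₀ : ℕ) (z₀ : Fin M₀ → E3) (c₀ : Fin M₀) (e : Fin M → Fin M₀),
    Admissible M z c ∧ CleanBall (63 / 10) z c ∧ MonoPhaseBall (63 / 10) z c ∧ ChartBy 𝓘 τ τ z c z₀ c₀ e ∧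
      ∃ a ∈ ball (63 / 10) z c, IsReach z c a ∧ dist (z a) (z c) ≤ ρ ∧ q + X M₀ z₀ c₀ (e a) < ‖siteForce 7 z a - linForce hessBlk0 force0 z c z₀ c₀ e a‖

/-- A witness with `q = κσ₁` refutes (SV κ X) (for `τ ≥ 0`). [formal bookkeeping] -/
theorem not_svCharge_of_witness {𝓘 : ChartFam} {τ ρ κ : ℝ} {X : SlackTab} (hτ : 0 ≤ τ) (hW : SVWitness 𝓘 τ ρ (κ * sigmaOne) X) : ¬SVCharge 𝓘 τ κ X := by
  rintro hS
  obtain ⟨M, z, c, M₀, z₀, c₀, e, hz, hcl, hm, hch, a, ha, hr, _, hlt⟩ := hW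
  have h := hS M z c M₀ z₀ c₀ e τ hz hcl hm hτ le_rfl hch (fineChart_of_chartBy hch) a ha hr
  linarith


/-! ## §2. The WINDOW lemma: admissible clusters are frustrated at every reach site (critic row 1186 (A6)(1); census ADM-35) -/

/-- ★ WINDOW: in an admissible cluster no reach site is `1/20`-good at fit scale `≤ 3/2` — the clause `¬ExemptNear (9/5) ExRec z c` of `Admissible`, unfolded.
Every law / certificate / witness format quantified over `Admissible` clusters carries this hypothesis for free. [formal bookkeeping] -/
theorem not_goodAtScale_of_admissible {M : ℕ} {z : Fin M → E3} {c a : Fin M} (hA : Admissible M z c) (ha : IsReach z c a) :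
    ¬GoodAtScale (1 / 20) (3 / 2) z a := by
  rintro hG
  obtain ⟨j, hj, hd⟩ := ha
  exact hA.2.2.2.2.1 ⟨j, hj, a, mem_ball.2 hd, Or.inr hG⟩

/-- ★ WINDOW, move half: in an admissible cluster no reach site has a one-atom-move/removal-unstable core (`R_m = 7`, `t = 10⁻⁴`, scale `≤ 3/2`). [formal bookkeeping] -/
theorem not_moveUnstable_of_admissible {M : ℕ} {z : Fin M → E3} {c a : Fin M} (hA : Admissible M z c) (ha : IsReach z c a) :
    ¬∃ s : ℝ, 0 ≤ s ∧ s ≤ 3 / 2 ∧ NonEquilibriumCore (-(7175 / 10000)) 0 7 s (1 / 10000) M z a := by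
  rintro hN
  obtain ⟨j, hj, hd⟩ := ha
  exact hA.2.2.2.2.1 ⟨j, hj, a, mem_ball.2 hd, Or.inl hN⟩

/-- The window in the shape a law-prover consumes: under the hypotheses of `InteriorTexLaw` / `SVCharge` / `TubeFloor` (admissible, charted), every reach row is
frustrated and move-stable. [formal bookkeeping] -/
theorem frustrated_of_admissible {M : ℕ} {z : Fin M → E3} {c : Fin M} (hA : Admissible M z c) :
    ∀ a, IsReach z c a → ¬GoodAtScale (1 / 20) (3 / 2) z a ∧ ¬∃ s : ℝ, 0 ≤ s ∧ s ≤ 3 / 2 ∧ NonEquilibriumCore (-(7175 / 10000)) 0 7 s (1 / 10000) M z a :=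
  fun _ ha => ⟨not_goodAtScale_of_admissible hA ha, not_moveUnstable_of_admissible hA ha⟩

end Summit.AtomisticToContinuum.Crystallization.Theorems.FrustratedLawDichotomyStrainedPatchSVCharge
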